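import Literature.MathematicalPhysics.QuantumLattice.WilsonDiracSliceBlocks
import Literature.MathematicalPhysics.QuantumFieldTheory.TorusSiteRP
import HarnessLib

/-!
# Antiperiodic temporal links, the site reflection and the slice blocks

For an `SU(N)` gauge field `U` on the torus `(ℤ/2T)⁴`, `2T = h + 1 + (h + 1)`, the antiperiodic
lift `apLift U` of `WilsonDiracAP` (the temporal links of the last layer carry the sign `-1` of
the antiperiodic boundary condition of the quark fields) has the same spatial slice blocks as
`U` and temporal blocks `w_t` (`t < 2T - 1`), `-w_{2T-1}`; hence
`det D_AP[U] = det (wilsonBlock a b a (update w last (-w last)))`. We also compute how the slice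
blocks transform under the site reflection `Θ₀` of `TorusSiteRP` in the hyperplanes `t = 0`,
`t = T`: `a_t(Θ₀U) = a_{-t}(U)`, `b_t(Θ₀U) = b_{-t}(U)`, `w_t(Θ₀U) = w_{-t-1}(U)ᴴ`, and that
`det w_t = 1` for `SU(N)` link variables (Osterwalder–Seiler, Ann. Phys. 110 (1978) 440, §3;
Montvay–Münster (1994) §4.2.3).
-/

noncomputable section

-- The time-slice index types (`((κ × Fin 2) ⊕ (κ × Fin 2)) × Fin (n+1)` and the Gram indices built
-- from them) are too deep for the default instance-search size bound (`DecidableEq`, needed by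
-- `Matrix.det`).
set_option synthInstance.maxSize 512

namespace Literature.MathematicalPhysics.QuantumLattice

section SliceReflection

open _root_.Matrix Literature.Probability.LatticeModels QuantumFieldTheory Literature.LinearAlgebra.Matrix
open scoped Kronecker ComplexOrder

variable {n N : ℕ}

local notation "𝕌" => Matrix.unitaryGroup (Fin N) ℂ
local notation "𝕊𝕌" => Matrix.specialUnitaryGroup (Fin N) ℂ
local notation "ρ₀" => unitaryFundamentalRep (Fin N) ℂ

/-! ### Coordinates of slice sites -/

/-- The time coordinate of a slice site. [folklore] -/
@[simp] theorem sliceSite_apply_zero (t : Fin (n + 1)) (y : Fin 3 → ZMod (n + 1)) :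
    sliceSite t y 0 = ZMod.finEquiv (n + 1) t := by
  simp [sliceSite]

/-- The spatial coordinates of a slice site. [folklore] -/
@[simp] theorem sliceSite_apply_succ (t : Fin (n + 1)) (y : Fin 3 → ZMod (n + 1)) (j : Fin 3) :
    sliceSite t y j.succ = y j := by
  simp [sliceSite]

/-- The site reflection `θ₀ (t, y) = (-t, y)` on slice sites. [folklore] -/
theorem siteTimeNeg_sliceSite (t : Fin (n + 1)) (y : Fin 3 → ZMod (n + 1)) :
    siteTimeNeg (sliceSite t y) = sliceSite (-t) y := by
  ext i
  refine Fin.cases ?_ (fun i => ?_) i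
  · simp [siteTimeNeg, sliceSite]
  · simp [siteTimeNeg, sliceSite, Fin.succ_ne_zero]

/-- The last time slice is the slice `t = -1`. [folklore] -/
theorem finEquiv_eq_neg_one_iff (t : Fin (n + 1)) :
    ZMod.finEquiv (n + 1) t = -1 ↔ t = Fin.last n := by
  rw [show (-1 : ZMod (n + 1)) = ZMod.finEquiv (n + 1) (Fin.last n) by
    rw [show (Fin.last n : Fin (n + 1)) = -1 from neg_eq_iff_eq_neg.mp (Fin.neg_last n),
      map_neg, map_one]]
  exact (ZMod.finEquiv (n + 1)).injective.eq_iff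

/-! ### The antiperiodic lift on slice links -/

/-- The antiperiodic lift on temporal slice links: the sign sits on the last layer. [folklore] -/
theorem apLift_sliceSite_zero (U : GaugeConfig 4 (n + 1) 𝕊𝕌) (t : Fin (n + 1))
    (y : Fin 3 → ZMod (n + 1)) :
    apLift U (sliceSite t y, 0) =
      if t = Fin.last n then -unitaryLift U (sliceSite t y, 0) else unitaryLift U (sliceSite t y, 0) := by
  simp only [apLift_apply, sliceSite_apply_zero, finEquiv_eq_neg_one_iff]

/-- **The temporal blocks of the antiperiodic lift**: `w̃_t = w_t` except `w̃_last = -w_last`. [folklore] -/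
theorem sliceLink_apLift (U : GaugeConfig 4 (n + 1) 𝕊𝕌) :
    sliceLink ρ₀ (apLift U) = Function.update (sliceLink ρ₀ (unitaryLift U)) (Fin.last n)
      (-(sliceLink ρ₀ (unitaryLift U) (Fin.last n))) := by
  funext t
  by_cases ht : t = Fin.last n
  · subst ht
    rw [Function.update_self]
    ext ⟨⟨y, a⟩, h⟩ ⟨⟨y', b⟩, h'⟩
    rw [Matrix.neg_apply, sliceLink_apply, sliceLink_apply, apLift_sliceSite_zero, if_pos rfl]
    simp only [unitaryFundamentalRep_apply, Unitary.coe_neg, coe_unitaryLift_apply]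
    split_ifs <;> simp
  · rw [Function.update_of_ne ht]
    ext ⟨⟨y, a⟩, h⟩ ⟨⟨y', b⟩, h'⟩
    rw [sliceLink_apply, sliceLink_apply, apLift_sliceSite_zero, if_neg ht]

/-- The spatial slice links of the antiperiodic lift do not see the temporal seam: the sign
depends only on the spatial coordinate. [folklore] -/
theorem apLift_sliceSite_succ (U : GaugeConfig 4 (n + 1) 𝕊𝕌) (t : Fin (n + 1))
    (y : Fin 3 → ZMod (n + 1)) (j : Fin 3) :
    apLift U (sliceSite t y, j.succ) =
      if y j = -1 then -unitaryLift U (sliceSite t y, j.succ) else unitaryLift U (sliceSite t y, j.succ) := by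
  simp only [apLift_apply, sliceSite_apply_succ]

/-! ### The site reflection on slice links and slice blocks -/

/-- **Spatial slice links of the reflected field**: `(Θ₀U)^(t, y; j) = U^(-t, y; j)`, also after the
antiperiodic lift. [folklore] -/
theorem apLift_siteReflect_sliceSite_succ (U : GaugeConfig 4 (n + 1) 𝕊𝕌) (t : Fin (n + 1))
    (y : Fin 3 → ZMod (n + 1)) (j : Fin 3) :
    apLift (torusConfigShift (Pi.single (0 : Fin 4) (1 : ZMod (n + 1))) U).timeReflect (sliceSite t y, j.succ) =
      apLift U (sliceSite (-t) y, j.succ) := by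
  rw [apLift_sliceSite_succ, apLift_sliceSite_succ]
  have h : unitaryLift (N := N) (torusConfigShift (Pi.single (0 : Fin 4) (1 : ZMod (n + 1))) U).timeReflect
      (sliceSite t y, j.succ) = unitaryLift U (sliceSite (-t) y, j.succ) := by
    rw [unitaryLift_apply, unitaryLift_apply, siteReflect_apply', if_neg (Fin.succ_ne_zero j),
      siteTimeNeg_sliceSite]
  rw [h]

/-- **Temporal slice links of the reflected field**: `(Θ₀U)(t, y; 0) = U(-(t+1), y; 0)⁻¹`. [folklore] -/
theorem unitaryLift_siteReflect_sliceSite_zero (U : GaugeConfig 4 (n + 1) 𝕊𝕌) (t : Fin (n + 1))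
    (y : Fin 3 → ZMod (n + 1)) :
    unitaryLift (N := N) (torusConfigShift (Pi.single (0 : Fin 4) (1 : ZMod (n + 1))) U).timeReflect
        (sliceSite t y, 0) = (unitaryLift U (sliceSite (-(t + 1)) y, 0))⁻¹ := by
  rw [unitaryLift_apply, unitaryLift_apply, siteReflect_apply', if_pos rfl, sliceSite_shift_zero,
    siteTimeNeg_sliceSite, map_inv]

/-- The forward spatial hopping of the reflected field in slice `t` is that of the field in
slice `-t`. [folklore] -/
theorem sliceHop_siteReflect (U : GaugeConfig 4 (n + 1) 𝕊𝕌) (t : Fin (n + 1)) (j : Fin 3) :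
    sliceHop ρ₀ (apLift (torusConfigShift (Pi.single (0 : Fin 4) (1 : ZMod (n + 1))) U).timeReflect) t j =
      sliceHop ρ₀ (apLift U) (-t) j := by
  simp only [sliceHop, apLift_siteReflect_sliceSite_succ]

/-- The backward spatial hopping of the reflected field. [folklore] -/
theorem sliceHop'_siteReflect (U : GaugeConfig 4 (n + 1) 𝕊𝕌) (t : Fin (n + 1)) (j : Fin 3) :
    sliceHop' ρ₀ (apLift (torusConfigShift (Pi.single (0 : Fin 4) (1 : ZMod (n + 1))) U).timeReflect) t j =
      sliceHop' ρ₀ (apLift U) (-t) j := by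
  simp only [sliceHop', apLift_siteReflect_sliceSite_succ]

/-- **The spatial diagonal block of the reflected field**: `a_t[Θ₀U] = a_{-t}[U]`. [folklore] -/
theorem sliceDiag_siteReflect (U : GaugeConfig 4 (n + 1) 𝕊𝕌) (m : ℝ) (t : Fin (n + 1)) :
    sliceDiag ρ₀ (apLift (torusConfigShift (Pi.single (0 : Fin 4) (1 : ZMod (n + 1))) U).timeReflect) m t =
      sliceDiag ρ₀ (apLift U) m (-t) := by
  simp only [sliceDiag, sliceHop_siteReflect, sliceHop'_siteReflect]

/-- **The spatial off-diagonal block of the reflected field**: `b_t[Θ₀U] = b_{-t}[U]`. [folklore] -/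
theorem sliceOff_siteReflect (U : GaugeConfig 4 (n + 1) 𝕊𝕌) (t : Fin (n + 1)) :
    sliceOff ρ₀ (apLift (torusConfigShift (Pi.single (0 : Fin 4) (1 : ZMod (n + 1))) U).timeReflect) t =
      sliceOff ρ₀ (apLift U) (-t) := by
  simp only [sliceOff, sliceHop_siteReflect, sliceHop'_siteReflect]

/-- The temporal link block of the reflected field: `(link block)_t[Θ₀U] = ((link block)_{-(t+1)}[U])ᴴ`. [folklore] -/
theorem timeLink_siteReflect (U : GaugeConfig 4 (n + 1) 𝕊𝕌) (t : Fin (n + 1)) :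
    timeLink ρ₀ (unitaryLift (torusConfigShift (Pi.single (0 : Fin 4) (1 : ZMod (n + 1))) U).timeReflect) t =
      (timeLink ρ₀ (unitaryLift U) (-(t + 1)))ᴴ := by
  ext ⟨y, a⟩ ⟨y', b⟩
  simp only [timeLink, Matrix.of_apply, Matrix.conjTranspose_apply, unitaryLift_siteReflect_sliceSite_zero]
  by_cases h : y = y'
  · subst h
    simp only [↓reduceIte]
    rw [unitaryRep_star_apply _ unitaryFundamentalRep_mem_unitaryGroup]
  · simp [h, Ne.symm h]

/-- **The temporal block of the reflected field**: `w_t[Θ₀U] = (w_{-(t+1)}[U])ᴴ`. [folklore] -/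
theorem sliceLink_siteReflect (U : GaugeConfig 4 (n + 1) 𝕊𝕌) (t : Fin (n + 1)) :
    sliceLink ρ₀ (unitaryLift (torusConfigShift (Pi.single (0 : Fin 4) (1 : ZMod (n + 1))) U).timeReflect) t =
      (sliceLink ρ₀ (unitaryLift U) (-(t + 1)))ᴴ := by
  rw [sliceLink, sliceLink, timeLink_siteReflect, Matrix.conjTranspose_kronecker, Matrix.conjTranspose_one]

/-! ### The temporal block has determinant one -/

/-- The temporal link block is the block diagonal matrix of the link variables (reindexed). [folklore] -/
theorem timeLink_eq_reindex_blockDiagonal {G : Type*} [Group G] (ρ : G →* Matrix (Fin N) (Fin N) ℂ)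
    (V : GaugeConfig 4 (n + 1) G) (t : Fin (n + 1)) :
    timeLink ρ V t = Matrix.reindex (Equiv.prodComm _ _) (Equiv.prodComm _ _)
      (Matrix.blockDiagonal fun y => ρ (V (sliceSite t y, 0))) := by
  ext ⟨y, a⟩ ⟨y', b⟩
  simp only [timeLink, Matrix.of_apply, Matrix.reindex_apply, Matrix.submatrix_apply,
    Equiv.prodComm_symm, Equiv.prodComm_apply, Prod.swap_prod_mk, Matrix.blockDiagonal_apply]

/-- **For `SU(N)` link variables the temporal block has determinant one.** [folklore] -/
theorem det_sliceLink_unitaryLift (U : GaugeConfig 4 (n + 1) 𝕊𝕌) (t : Fin (n + 1)) :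
    (sliceLink ρ₀ (unitaryLift U) t).det = 1 := by
  have hdet : (timeLink ρ₀ (unitaryLift U) t).det = 1 := by
    rw [timeLink_eq_reindex_blockDiagonal, Matrix.det_reindex_self, Matrix.det_blockDiagonal]
    refine Finset.prod_eq_one fun y _ => ?_
    rw [unitaryFundamentalRep_apply, coe_unitaryLift_apply]
    exact (Matrix.mem_specialUnitaryGroup_iff.1 (U (sliceSite t y, 0)).2).2
  rw [sliceLink, Matrix.det_kronecker, hdet, Matrix.det_one, one_pow, one_pow, mul_one]

end SliceReflection

end Literature.MathematicalPhysics.QuantumLattice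

end
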